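import Mathlib
import HarnessLib
import Literature.MathematicalPhysics.QuantumLattice.HubbardGridCharacters
import Literature.MathematicalPhysics.QuantumLattice.HubbardGridSymbolCharSums
import Literature.MathematicalPhysics.QuantumLattice.HubbardGridTwoPointBound
import Literature.MathematicalPhysics.QuantumLattice.HubbardUVSymbolCTDifferences
import Literature.MathematicalPhysics.QuantumLattice.HubbardUVSymbolBandComposition
import Summits.HubbardSuperconductivity.HubbardSuperconductivity.Theorems.KLProgrammeKLRegimeTwoVolumeResummedSymbolSizes
import Summits.HubbardSuperconductivity.HubbardSuperconductivity.Theorems.KLProgrammeKLRegimeTwoVolumeReadoutPin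
import Summits.HubbardSuperconductivity.HubbardSuperconductivity.Theorems.KLProgrammeKLRegimeTwoVolumeTorusBlocks

/-!
# β′ two-volume pass — the SECTIONAL (fixed-time) spatial decay of the pulled-back ultraviolet covariance `S_Lᵀ C^K_{>Λ} S_L`
# (the ε-free one-volume datum `hsec` of `hubbardGrid_sum_norm_kernel_sub_le_response`); cell gate-hubbard-kl, seat hubbard-kl-k3c4-p2 (g7)

k3c5-p2's response-form two-volume step reads, besides the all-times row data (`Θ(N/β)`), ONE datum that must be free of `ε = β/N`: the
fixed-time far spatial sums `Σ_{y : R < tnorm(x′−y)} ‖G X′ (((t,y),σ),c)‖ ≤ Te` of the grid covariance `G = S_Lᵀ·normalCovariance(p)·S_L`.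

§1 (generic grid layer, any normal symbol `p((i,k⃗),σ) = (βL²)·u_σ(i,k⃗)`): at a fixed pair of grid times the character sum of the `(+,−)` entry
is a MATSUBARA SUM OF SPATIAL POSITION KERNELS `β⁻¹ Σ_i χ_i(j−j′)·ǔ_i(x−y)` (`charSum_gridSymbol_eq_sum_torusFourierInv`), so the `tnorm`-first
moment of a fixed-time row is `≤ |β|⁻¹ Σ_i M₁(ǔ_i)` (`sum_tnorm_mul_norm_gridSub_pullback_sectional_le`: both charge orders; equal charges /
different spins vanish).  One pair of times, no time sum: no `ε`.  The `z = 0` term, which alone carries the conditionally convergent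
`Σ_i e^{iθi}/(−iω_i)`, has weight `tnorm 0 = 0`; the sup entry comes separately from replica-Gram-boundedness + antisymmetry
(`norm_gridSub_pullback_apply_le_of_isGramBoundedR`).

§2 (the model symbol `p = uvSymbolCT L M β μ K Λ`, `u_i(q⃗) = Ψ(ω_i, e_K(p_{q⃗}))`): the first moment of the sampled symbol at ONE frequency WITH
the frequency envelope, `M₁(ǔ_ω) ≤ (2/m(ω))²·12B(2π(1+4/Λ)D + 12π²(1+4/Λ)²D² + 144π³(1+4/Λ)³D³)`, `m(ω) = max(|ω|, Λ/2)`
(`sum_tnorm_norm_torusFourierInv_uvBandSymbol_le_env`; the `ω`-uniform twin `sum_tnorm_norm_torusFourierInv_uvBandSymbol_le` of k3c5-p1 has `4/Λ`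
for `2/m(ω)` and is not summable over the frequencies) — the second power of the envelope comes from subtracting the constant `Ψ(ω, e_K(q))`
before the Faà di Bruno step (`norm_iteratedFDeriv_uvBandSymbol_le_env`: a derivative of order `n ≥ 1` of the composite sees only `DⁱΨ`, `i ≥ 1`).
With `Σ_i m(ω_i)⁻² ≤ 2β/Λ` (`sum_inv_uvEnv_pow_le`) the `β⁻¹` cancels:
**`sum_tnorm_mul_norm_gridSub_hubbardCovAboveCT_sectional_le`** `Σ_y tnorm(x′−y)·‖(S_LᵀC^K_{>Λ}S_L) X′ (((t,y),σ),c)‖ ≤ 96B(…)/Λ` uniformly in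
`M`, `N ≥ 2M`, `L`, `β`, the times and legs; the far-sum (`hsec`) and sup-entry (`hs`) shapes and the scale-`0` numerals are in `…TwoVolumeSectionalMomentScaleZero`.

Proofs only; no definitions; nothing about the model beyond identities and bounds.  References: BGM 2006 §2.1 (2.3)–(2.5), Lemma 2.2
[cite: BenfattoGiulianiMastropietro2006]; Friedli–Velenik 2017 §10.4.
-/

noncomputable section

namespace Summit.HubbardSuperconductivity.HubbardSuperconductivity.Theorems.TwoVolumeDefect

set_option linter.dupNamespace false -- summit = problem name (single-conjunct summit), D-0017

open Finset Complex Literature.MathematicalPhysics.QuantumLattice Literature.Probability.LatticeModels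
open Summit.HubbardSuperconductivity.HubbardSuperconductivity.Theorems.KLRegimeSplit
open Summit.HubbardSuperconductivity.HubbardSuperconductivity.Theorems.DispersionFlow
open Summit.HubbardSuperconductivity.HubbardSuperconductivity.Theorems.SampledSymbolKernel
open scoped ComplexConjugate Nat

/-! ## §1 Generic grid layer: a fixed-time row of `Sᵀ·normalCovariance(p)·S` as a Matsubara sum of spatial position kernels -/

section Generic

variable {L M N : ℕ} [NeZero L] [NeZero N]

/-- **The fixed-time character sum is a Matsubara sum of spatial position kernels**: for a symbol `p((i,k⃗),σ) = (βL²)·u_σ(i,k⃗)`,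
`Σ_{q₀,q⃗} χ_{q₀}(a) χ_{q⃗}(z) G_σ(q₀,q⃗) = β⁻¹·Σ_i χ_{i}(a)·(u_σ i)ˇ(z)` (`2M ≤ N`, `β ≠ 0`). -/
theorem charSum_gridSymbol_eq_sum_torusFourierInv (hN : 2 * M ≤ N) {β : ℝ} (hβ : β ≠ 0)
    (p : FreqMomentum L M × Fin 2 → ℂ) (u : Fin 2 → MatsubaraIdx M → TorusSite 2 L → ℂ)
    (hp : ∀ (i : MatsubaraIdx M) (kv : TorusSite 2 L) (σ : Fin 2), p ((i, kv), σ) = ((β * (L : ℝ) ^ 2 : ℝ) : ℂ) * u σ i kv)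
    (σ : Fin 2) (a : TorusSite 1 N) (z : TorusSite 2 L) :
    ∑ q₀ : TorusSite 1 N, ∑ qv : TorusSite 2 L, torusChar q₀ a * torusChar qv z * gridSymbol L M N β p σ q₀ qv =
      ((1 / β : ℝ) : ℂ) * ∑ i : MatsubaraIdx M, torusChar (fun _ : Fin 1 => ((i : ℕ) : ZMod N)) a * torusFourierInv (u σ i) z := by
  classical
  have hL : ((L : ℝ) : ℂ) ≠ 0 := by exact_mod_cast NeZero.ne L
  have hβ' : (β : ℂ) ≠ 0 := by exact_mod_cast hβ
  -- the inner spatial sum at one Matsubara index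
  have hinner : ∀ i : MatsubaraIdx M, ∑ qv : TorusSite 2 L, torusChar qv z * (((1 / (β * (L : ℝ) ^ 2) : ℝ) : ℂ) ^ 2 * p ((i, qv), σ)) =
      ((1 / β : ℝ) : ℂ) * torusFourierInv (u σ i) z := by
    intro i
    rw [torusFourierInv_eq_sum_torusChar, ← mul_assoc, Finset.mul_sum]
    refine sum_congr rfl fun qv _ => ?_
    rw [hp]
    push_cast
    field_simp
  calc ∑ q₀ : TorusSite 1 N, ∑ qv : TorusSite 2 L, torusChar q₀ a * torusChar qv z * gridSymbol L M N β p σ q₀ qv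
      = ∑ q₀ : TorusSite 1 N, torusChar q₀ a *
          (if h : (q₀ 0).val < 2 * M then ((1 / β : ℝ) : ℂ) * torusFourierInv (u σ ⟨(q₀ 0).val, h⟩) z else 0) := by
        refine sum_congr rfl fun q₀ _ => ?_
        by_cases h : (q₀ 0).val < 2 * M
        · rw [dif_pos h, ← hinner ⟨_, h⟩, Finset.mul_sum]
          refine sum_congr rfl fun qv _ => ?_
          rw [gridSymbol, dif_pos h]
          ring
        · rw [dif_neg h, mul_zero]
          refine sum_eq_zero fun qv _ => ?_
          rw [gridSymbol, dif_neg h, mul_zero]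
    _ = ((1 / β : ℝ) : ℂ) * ∑ i : MatsubaraIdx M, torusChar (fun _ : Fin 1 => ((i : ℕ) : ZMod N)) a * torusFourierInv (u σ i) z := by
        rw [Finset.mul_sum, sum_torusSite_one_dite hN (fun i : MatsubaraIdx M =>
          ((1 / β : ℝ) : ℂ) * (torusChar (fun _ : Fin 1 => ((i : ℕ) : ZMod N)) a * torusFourierInv (u σ i) z))]
        refine sum_congr rfl fun q₀ _ => ?_
        by_cases h : (q₀ 0).val < 2 * M
        · rw [dif_pos h, dif_pos h]
          have hq₀ : (fun _ : Fin 1 => (((⟨(q₀ 0).val, h⟩ : MatsubaraIdx M) : ℕ) : ZMod N)) = q₀ := by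
            funext l
            rw [Subsingleton.elim l 0]
            simp only [ZMod.natCast_val, ZMod.cast_id', id_eq]
          rw [hq₀]
          ring
        · rw [dif_neg h, dif_neg h, mul_zero]

/-- Hence `‖Σ_{q₀,q⃗} χ_{q₀}(a) χ_{q⃗}(z) G_σ(q₀,q⃗)‖ ≤ |β|⁻¹·Σ_i ‖(u_σ i)ˇ(z)‖`. -/
theorem norm_charSum_gridSymbol_le_sum (hN : 2 * M ≤ N) {β : ℝ} (hβ : β ≠ 0)
    (p : FreqMomentum L M × Fin 2 → ℂ) (u : Fin 2 → MatsubaraIdx M → TorusSite 2 L → ℂ)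
    (hp : ∀ (i : MatsubaraIdx M) (kv : TorusSite 2 L) (σ : Fin 2), p ((i, kv), σ) = ((β * (L : ℝ) ^ 2 : ℝ) : ℂ) * u σ i kv)
    (σ : Fin 2) (a : TorusSite 1 N) (z : TorusSite 2 L) :
    ‖∑ q₀ : TorusSite 1 N, ∑ qv : TorusSite 2 L, torusChar q₀ a * torusChar qv z * gridSymbol L M N β p σ q₀ qv‖ ≤
      |β|⁻¹ * ∑ i : MatsubaraIdx M, ‖torusFourierInv (u σ i) z‖ := by
  rw [charSum_gridSymbol_eq_sum_torusFourierInv hN hβ p u hp σ a z, norm_mul, Complex.norm_real, Real.norm_eq_abs, abs_div,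
    abs_one, one_div]
  refine mul_le_mul_of_nonneg_left ((norm_sum_le _ _).trans (sum_le_sum fun i _ => ?_)) (inv_nonneg.2 (abs_nonneg β))
  rw [norm_mul, norm_torusChar, one_mul]

/-- **THE `tnorm`-FIRST MOMENT OF A FIXED-TIME ROW** of `G = Sᵀ·normalCovariance(p)·S` on the `N`-point grid (`2M ≤ N`, `β ≠ 0`): if
`p((i,k⃗),σ) = (βL²)·u_σ(i,k⃗)` and `Σ_z tnorm(z)·‖(u_σ i)ˇ(z)‖ ≤ W i` for every spin and frequency, then for every leg `X′`, time `t`,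
spin `σ` and charge `c`: `Σ_y tnorm(x′ − y)·‖G X′ (((t,y),σ),c)‖ ≤ |β|⁻¹·Σ_i W i` (one pair of times: no `ε = β/N`). -/
theorem sum_tnorm_mul_norm_gridSub_pullback_sectional_le (hN : 2 * M ≤ N) {β : ℝ} (hβ : β ≠ 0)
    (p : FreqMomentum L M × Fin 2 → ℂ) (u : Fin 2 → MatsubaraIdx M → TorusSite 2 L → ℂ)
    (hp : ∀ (i : MatsubaraIdx M) (kv : TorusSite 2 L) (σ : Fin 2), p ((i, kv), σ) = ((β * (L : ℝ) ^ 2 : ℝ) : ℂ) * u σ i kv)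
    {W : MatsubaraIdx M → ℝ}
    (hW : ∀ (σ : Fin 2) (i : MatsubaraIdx M), ∑ z : TorusSite 2 L, (Torus.tnorm z : ℝ) * ‖torusFourierInv (u σ i) z‖ ≤ W i)
    (X' : GridLeg (GridPoint L N)) (t : Fin N) (σ c : Fin 2) :
    ∑ y : TorusSite 2 L, (Torus.tnorm (X'.1.1.2 - y) : ℝ) *
        ‖((hubbardGridSub L M β N).transpose * normalCovariance L M p * hubbardGridSub L M β N) X' (((t, y), σ), c)‖ ≤
      |β|⁻¹ * ∑ i : MatsubaraIdx M, W i := by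
  classical
  obtain ⟨⟨⟨j, x⟩, σ'⟩, c'⟩ := X'
  set G := (hubbardGridSub L M β N).transpose * normalCovariance L M p * hubbardGridSub L M β N with hG
  have hβ0 : 0 ≤ |β|⁻¹ := inv_nonneg.2 (abs_nonneg β)
  have hW0 : 0 ≤ |β|⁻¹ * ∑ i : MatsubaraIdx M, W i :=
    mul_nonneg hβ0 (sum_nonneg fun i _ => le_trans (sum_nonneg fun z _ => by positivity) (hW σ i))
  -- the estimate for ONE spatial character-sum kernel
  have hker : ∀ a : TorusSite 1 N, ∑ zv : TorusSite 2 L, (Torus.tnorm zv : ℝ) *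
      ‖∑ q₀ : TorusSite 1 N, ∑ qv : TorusSite 2 L, torusChar q₀ a * torusChar qv zv * gridSymbol L M N β p σ q₀ qv‖ ≤
        |β|⁻¹ * ∑ i : MatsubaraIdx M, W i := by
    intro a
    calc ∑ zv : TorusSite 2 L, (Torus.tnorm zv : ℝ) *
          ‖∑ q₀ : TorusSite 1 N, ∑ qv : TorusSite 2 L, torusChar q₀ a * torusChar qv zv * gridSymbol L M N β p σ q₀ qv‖
        ≤ ∑ zv : TorusSite 2 L, (Torus.tnorm zv : ℝ) * (|β|⁻¹ * ∑ i : MatsubaraIdx M, ‖torusFourierInv (u σ i) zv‖) :=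
          sum_le_sum fun zv _ => mul_le_mul_of_nonneg_left (norm_charSum_gridSymbol_le_sum hN hβ p u hp σ a zv) (Nat.cast_nonneg _)
      _ = |β|⁻¹ * ∑ i : MatsubaraIdx M, ∑ zv : TorusSite 2 L, (Torus.tnorm zv : ℝ) * ‖torusFourierInv (u σ i) zv‖ := by
          rw [Finset.sum_comm, Finset.mul_sum]
          refine sum_congr rfl fun zv _ => ?_
          rw [Finset.mul_sum, Finset.mul_sum, Finset.mul_sum]
          exact sum_congr rfl fun i _ => by ring
      _ ≤ |β|⁻¹ * ∑ i : MatsubaraIdx M, W i := mul_le_mul_of_nonneg_left (sum_le_sum fun i _ => hW σ i) hβ0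
  by_cases hc : c' = c
  · -- equal charges never contract
    have h0 : ∀ y : TorusSite 2 L, G (((j, x), σ'), c') (((t, y), σ), c) = 0 := fun y =>
      gridSub_pullback_normalCovariance_apply_of_charge_eq β _ _ p (Y := (((j, x), σ'), c')) (Y' := (((t, y), σ), c)) hc
    simp only [h0, norm_zero, mul_zero, sum_const_zero]
    exact hW0
  by_cases hs : σ' = σ
  swap
  · -- different spins never contract
    have h0 : ∀ y : TorusSite 2 L, G (((j, x), σ'), c') (((t, y), σ), c) = 0 := fun y =>
      gridSub_pullback_normalCovariance_apply_of_spin_ne β _ _ p (Y := (((j, x), σ'), c')) (Y' := (((t, y), σ), c)) hs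
    simp only [h0, norm_zero, mul_zero, sum_const_zero]
    exact hW0
  subst hs
  -- the two charge orders
  have key : ∀ i : Fin 2, i = 0 ∨ i = 1 := by decide
  rcases key c' with rfl | rfl <;> rcases key c with rfl | rfl
  · exact absurd rfl hc
  · -- `(+,−)`: the entry is the character sum at `a = j − t`, `z = x − y`
    have hent : ∀ y : TorusSite 2 L, ‖G (((j, x), σ'), 0) (((t, y), σ'), 1)‖ =
        ‖∑ q₀ : TorusSite 1 N, ∑ qv : TorusSite 2 L,
          torusChar q₀ (fun _ : Fin 1 => ((j : ℕ) : ZMod N) - ((t : ℕ) : ZMod N)) * torusChar qv (x - y) * gridSymbol L M N β p σ' q₀ qv‖ :=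
      fun y => norm_gridSub_pullback_apply_zero_one_eq hβ hN p j t x y σ'
    simp_rw [hent]
    refine (Fintype.sum_equiv (Equiv.subLeft x) _ (fun zv : TorusSite 2 L => (Torus.tnorm zv : ℝ) *
        ‖∑ q₀ : TorusSite 1 N, ∑ qv : TorusSite 2 L,
          torusChar q₀ (fun _ : Fin 1 => ((j : ℕ) : ZMod N) - ((t : ℕ) : ZMod N)) * torusChar qv zv * gridSymbol L M N β p σ' q₀ qv‖)
      (fun y => rfl)).trans_le (hker _)
  · -- `(−,+)`: minus the transposed `(+,−)` entry, character sum at `a = t − j`, `z = y − x`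
    have hent : ∀ y : TorusSite 2 L, ‖G (((j, x), σ'), 1) (((t, y), σ'), 0)‖ =
        ‖∑ q₀ : TorusSite 1 N, ∑ qv : TorusSite 2 L,
          torusChar q₀ (fun _ : Fin 1 => ((t : ℕ) : ZMod N) - ((j : ℕ) : ZMod N)) * torusChar qv (y - x) * gridSymbol L M N β p σ' q₀ qv‖ := by
      intro y
      have h10 : G (((j, x), σ'), 1) (((t, y), σ'), 0) = -G (((t, y), σ'), 0) (((j, x), σ'), 1) :=
        gridSub_pullback_normalCovariance_apply_one_zero β _ _ p _ _ _ _
      rw [h10, norm_neg]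
      exact norm_gridSub_pullback_apply_zero_one_eq hβ hN p t j y x σ'
    have htn : ∀ y : TorusSite 2 L, (Torus.tnorm (x - y) : ℝ) = Torus.tnorm (y - x) := by
      intro y
      rw [← neg_sub y x]
      exact_mod_cast le_antisymm (Torus.tnorm_neg_le (y - x)) (by simpa using Torus.tnorm_neg_le (-(y - x)))
    simp_rw [hent]
    refine (Fintype.sum_equiv (Equiv.subRight x) _ (fun zv : TorusSite 2 L => (Torus.tnorm zv : ℝ) *
        ‖∑ q₀ : TorusSite 1 N, ∑ qv : TorusSite 2 L,
          torusChar q₀ (fun _ : Fin 1 => ((t : ℕ) : ZMod N) - ((j : ℕ) : ZMod N)) * torusChar qv zv * gridSymbol L M N β p σ' q₀ qv‖)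
      (fun y => by rw [htn y]; rfl)).trans_le (hker _)
  · exact absurd rfl hc

omit [NeZero N] in
/-- **The sup entry of an antisymmetric replica-Gram-bounded pullback**: `‖(Sᵀ·normalCovariance(p)·S) X Y‖ ≤ κ²`. -/
theorem norm_gridSub_pullback_apply_le_of_isGramBoundedR {β : ℝ} (p : FreqMomentum L M × Fin 2 → ℂ) {κ : ℝ}
    (hGB : IsGramBoundedR ((hubbardGridSub L M β N).transpose * normalCovariance L M p * hubbardGridSub L M β N) κ)
    (X Y : GridLeg (GridPoint L N)) :
    ‖((hubbardGridSub L M β N).transpose * normalCovariance L M p * hubbardGridSub L M β N) X Y‖ ≤ κ ^ 2 := by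
  set G := (hubbardGridSub L M β N).transpose * normalCovariance L M p * hubbardGridSub L M β N with hG
  have hT : G Y X = -G X Y := by
    have h := congrFun (congrFun (gridSub_pullback_normalCovariance_transpose β (fun q : GridPoint L N => q.2)
      (fun q => gridTime β N q.1) p) X) Y
    rw [Matrix.transpose_apply, Matrix.neg_apply] at h
    exact h
  have h := IsGramBoundedR.norm_pairing_le hGB X Y
  rw [hT, show -G X Y - G X Y = (-2 : ℂ) * G X Y by ring, ← mul_assoc] at h
  have h2 : ((1 / 2 : ℚ) • (1 : ℂ)) * (-2 : ℂ) = -1 := by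
    rw [Rat.smul_one_eq_cast]
    push_cast
    ring
  rwa [h2, neg_one_mul, norm_neg] at h

end Generic

/-! ## §2 The model: the ultraviolet symbol above `Λ` in the frame `K`, per-frequency moments with the envelope `m(ω)⁻²`, the frequency sum -/

section Model

variable {L M N : ℕ} [NeZero L] [NeZero N]

/-- **Fréchet sizes of the composed symbol WITH THE FREQUENCY ENVELOPE**: for `1 ≤ n ≤ 3`, cutoff numerals `‖Dⁱχ₂‖ ≤ B` (`i ≤ 3`,
`1 ≤ B`) and band sizes `‖Dⁱe_K‖ ≤ Dⁱ` (`1 ≤ i ≤ 3`, `0 ≤ D`):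
`‖Dⁿ(Ψ(ω, e_K ·))(q)‖ ≤ n!·(B(n+1)!(1+4/Λ)^{n}(2/m(ω))²)·Dⁿ`, `m(ω) = max(|ω|, Λ/2)` — only the derivatives `DⁱΨ`, `1 ≤ i ≤ n`, of
the outer function enter a derivative of order `n ≥ 1` of the composite (subtract the constant `Ψ(ω, e_K(q))`), and each is
`≤ B(i+1)!(2/m)^{i+1} ≤ B(n+1)!(2/m)²(1+4/Λ)^{n}` (`2/m ≤ 4/Λ ≤ 1 + 4/Λ`). -/
theorem norm_iteratedFDeriv_uvBandSymbol_le_env {Λ : ℝ} (hΛ : 0 < Λ) {B : ℝ} (hB1 : 1 ≤ B)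
    (hB : ∀ i ≤ 3, ∀ t, ‖iteratedDeriv i salmhoferCutoff t‖ ≤ B) {μ : ℝ} {K : TrigPolyC4v} {D : ℝ}
    (hD : ∀ i, 1 ≤ i → i ≤ 3 → ∀ p : Momentum, ‖iteratedFDeriv ℝ i (frameLevel μ K) p‖ ≤ D ^ i) (ω : ℝ) {n : ℕ}
    (hn1 : 1 ≤ n) (hn : n ≤ 3) (q : Momentum) :
    ‖iteratedFDeriv ℝ n (fun p : Momentum => uvSymbol₂ 1 Λ (fbPt ω (frameLevel μ K p))) q‖ ≤
      n ! * (B * (n + 1)! * (1 + 4 / Λ) ^ n * (2 / max |ω| (Λ / 2)) ^ 2) * D ^ n := by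
  set m : ℝ := max |ω| (Λ / 2) with hm
  have hm0 : 0 < m := lt_max_of_lt_right (by positivity)
  have hB0 : 0 ≤ B := zero_le_one.trans hB1
  have h2m : 2 / m ≤ 4 / Λ := by
    rw [div_le_div_iff₀ hm0 hΛ]
    nlinarith [le_max_right |ω| (Λ / 2)]
  have h2m' : 2 / m ≤ 1 + 4 / Λ := h2m.trans (by linarith)
  have h14 : (1 : ℝ) ≤ 1 + 4 / Λ := le_add_of_nonneg_right (by positivity)
  -- the composite with the constant subtracted
  set f : Momentum → FreqBand := fun p => fbPt ω (frameLevel μ K p) with hf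
  set cst : ℂ := uvSymbol₂ 1 Λ (f q) with hcst
  set g : FreqBand → ℂ := uvSymbol₂ 1 Λ - fun _ => cst with hg
  have hfC : ContDiff ℝ (n : ℕ∞) f := contDiff_fbPt_comp ((EngineV8.contDiff_frameLevel μ K).of_le le_top) ω
  have hgC : ContDiff ℝ (n : ℕ∞) g := (contDiff_uvSymbol₂ 1 hΛ).sub contDiff_const
  have hgfC : ContDiff ℝ (n : ℕ∞) (g ∘ f) := hgC.comp hfC
  have hsplit : (fun p : Momentum => uvSymbol₂ 1 Λ (fbPt ω (frameLevel μ K p))) = g ∘ f + fun _ => cst := by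
    funext p
    simp only [hg, hf, Pi.add_apply, Pi.sub_apply, Function.comp_apply, sub_add_cancel]
  have hn0 : n ≠ 0 := by omega
  rw [hsplit, iteratedFDeriv_add_apply hgfC.contDiffAt contDiff_const.contDiffAt, iteratedFDeriv_const_of_ne hn0,
    Pi.zero_apply, add_zero]
  -- Faà di Bruno (crude) for `g ∘ f`
  have hC : ∀ i ≤ n, ‖iteratedFDeriv ℝ i g (f q)‖ ≤ B * (n + 1)! * (1 + 4 / Λ) ^ n * (2 / m) ^ 2 := by
    intro i hi
    rcases Nat.eq_zero_or_pos i with rfl | hi1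
    · rw [norm_iteratedFDeriv_zero, hg]
      simp only [hcst, Pi.sub_apply, sub_self, norm_zero]
      positivity
    · have hsub : iteratedFDeriv ℝ i g (f q) = iteratedFDeriv ℝ i (uvSymbol₂ 1 Λ) (f q) := by
        rw [hg, iteratedFDeriv_sub_apply ((contDiff_uvSymbol₂ 1 hΛ (n := (i : ℕ∞))).contDiffAt) contDiff_const.contDiffAt,
          iteratedFDeriv_const_of_ne (by omega : i ≠ 0), Pi.zero_apply, sub_zero]
      rw [hsub]
      have h := norm_iteratedFDeriv_uvSymbol₂_le (c := 1) zero_le_one hΛ hB1 hB (hi.trans hn) (f q)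
      rw [one_mul, hf] at h
      simp only [fbPt_apply_zero] at h
      rw [← hm] at h
      refine h.trans ?_
      have hfac : ((i + 1)! : ℝ) ≤ (n + 1)! := by exact_mod_cast Nat.factorial_le (by omega)
      obtain ⟨k, rfl⟩ : ∃ k, i = k + 1 := ⟨i - 1, by omega⟩
      have hpow : (2 / m) ^ (k + 1 + 1) = (2 / m) ^ 2 * (2 / m) ^ k := by ring
      rw [hpow]
      have hk : (2 / m) ^ k ≤ (1 + 4 / Λ) ^ n :=
        (pow_le_pow_left₀ (by positivity) h2m' k).trans (pow_le_pow_right₀ h14 (by omega))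
      calc B * ((k + 1 + 1)! : ℝ) * ((2 / m) ^ 2 * (2 / m) ^ k)
          ≤ B * (n + 1)! * ((2 / m) ^ 2 * (1 + 4 / Λ) ^ n) := by gcongr
        _ = B * (n + 1)! * (1 + 4 / Λ) ^ n * (2 / m) ^ 2 := by ring
  have hD' : ∀ i, 1 ≤ i → i ≤ n → ‖iteratedFDeriv ℝ i f q‖ ≤ D ^ i := by
    intro i hi1 hin
    rw [hf, norm_iteratedFDeriv_fbPt_comp hi1 ((EngineV8.contDiff_frameLevel μ K).of_le le_top) ω q]
    exact hD i hi1 (hin.trans hn) q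
  exact norm_iteratedFDeriv_comp_le (g := g) (f := f) (N := (n : ℕ∞)) hgC hfC le_rfl q hC hD'

/-- **`M₁(ǔ_ω)` WITH THE FREQUENCY ENVELOPE** — the first `tnorm`-moment of the position kernel of the sampled symbol
`u(q⃗) = Ψ(ω, e_K(p_{q⃗}))`, uniformly in `L`:
`Σ_x tnorm(x)·‖ǔ(x)‖ ≤ (2/m(ω))²·12B(2π(1+4/Λ)D + 12π²(1+4/Λ)²D² + 144π³(1+4/Λ)³D³)`. -/
theorem sum_tnorm_norm_torusFourierInv_uvBandSymbol_le_env {Λ : ℝ} (hΛ : 0 < Λ) {B : ℝ} (hB1 : 1 ≤ B)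
    (hB : ∀ i ≤ 3, ∀ t, ‖iteratedDeriv i salmhoferCutoff t‖ ≤ B) {μ : ℝ} {K : TrigPolyC4v} {D : ℝ}
    (hD : ∀ i, 1 ≤ i → i ≤ 3 → ∀ p : Momentum, ‖iteratedFDeriv ℝ i (frameLevel μ K) p‖ ≤ D ^ i) (ω : ℝ) :
    ∑ x : TorusSite 2 L, (Torus.tnorm x : ℝ) *
        ‖torusFourierInv (fun k => uvSymbolFn 1 Λ (-2 * (∑ l : Fin 2, Real.cos (latticeMomentum L k l)) - μ - K.eval (latticeMomentum L k)) ω) x‖ ≤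
      (2 / max |ω| (Λ / 2)) ^ 2 * (12 * B * (2 * Real.pi * (1 + 4 / Λ) * D + 12 * Real.pi ^ 2 * (1 + 4 / Λ) ^ 2 * D ^ 2 +
        144 * Real.pi ^ 3 * (1 + 4 / Λ) ^ 3 * D ^ 3)) := by
  set F : EuclideanSpace ℝ (Fin 2) → ℂ := fun p => uvSymbol₂ 1 Λ (fbPt ω (frameLevel μ K p)) with hF
  have hsample : (fun k : TorusSite 2 L => uvSymbolFn 1 Λ (-2 * (∑ l : Fin 2, Real.cos (latticeMomentum L k l)) - μ - K.eval (latticeMomentum L k)) ω) =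
      fun k => F (WithLp.toLp 2 (latticeMomentum L k)) := by
    funext k; rw [hF]; dsimp only; rw [uvSymbol₂_fbPt_frameLevel_toLp, ctBandFn_eq_sum]
  rw [hsample]
  set t : ℝ := 2 / max |ω| (Λ / 2) with ht
  have h1 := fun q => norm_iteratedFDeriv_uvBandSymbol_le_env (μ := μ) (K := K) hΛ hB1 hB hD ω (n := 1) le_rfl (by norm_num) q
  have h2 := fun q => norm_iteratedFDeriv_uvBandSymbol_le_env (μ := μ) (K := K) hΛ hB1 hB hD ω (n := 2) (by norm_num) (by norm_num) q
  have h3 := fun q => norm_iteratedFDeriv_uvBandSymbol_le_env (μ := μ) (K := K) hΛ hB1 hB hD ω (n := 3) (by norm_num) le_rfl q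
  have h1' : ∀ q, ‖iteratedFDeriv ℝ 1 F q‖ ≤ 2 * B * (1 + 4 / Λ) * t ^ 2 * D := by
    intro q
    refine (h1 q).trans (le_of_eq ?_)
    rw [← ht, show Nat.factorial 1 = 1 from rfl, show (1 + 1)! = 2 from rfl]
    push_cast
    ring
  have h2' : ∀ q, ‖iteratedFDeriv ℝ 2 F q‖ ≤ 12 * B * (1 + 4 / Λ) ^ 2 * t ^ 2 * D ^ 2 := by
    intro q
    refine (h2 q).trans (le_of_eq ?_)
    rw [← ht, show Nat.factorial 2 = 2 from rfl, show (2 + 1)! = 6 from rfl]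
    push_cast
    ring
  have h3' : ∀ q, ‖iteratedFDeriv ℝ 3 F q‖ ≤ 144 * B * (1 + 4 / Λ) ^ 3 * t ^ 2 * D ^ 3 := by
    intro q
    refine (h3 q).trans (le_of_eq ?_)
    rw [← ht, show Nat.factorial 3 = 6 from rfl, show (3 + 1)! = 24 from rfl]
    push_cast
    ring
  have h := sum_tnorm_mul_norm_torusFourierInv_sampled_le_of_fderiv (L := L) F (uvBandSymbol_periodic Λ ω μ K)
    (by exact_mod_cast (contDiff_uvBandSymbol Λ ω μ K hΛ (n := 3))) (R := 1) le_rfl h1' h2' h3'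
  refine h.trans (le_of_eq ?_)
  simp only [Nat.cast_one, mul_one, div_one, one_pow]
  ring

/-- **THE SECTIONAL FIRST MOMENT OF THE PULLED-BACK ULTRAVIOLET COVARIANCE** `G = S_Lᵀ·C^K_{>Λ}·S_L` (seed `0`) on the `N`-point grid
(`2M ≤ N`, `0 < β`, `0 < Λ`): for cutoff numerals `B` and band sizes `D` as above, every leg `X′`, grid time `t`, spin `σ`, charge `c`:
`Σ_y tnorm(x′−y)·‖G X′ (((t,y),σ),c)‖ ≤ 96B(2πD + 12π²(1+4/Λ)D² + 144π³(1+4/Λ)²D³)/Λ` — uniform in `M`, `N`, `L`, `β`, the times. -/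
theorem sum_tnorm_mul_norm_gridSub_hubbardCovAboveCT_sectional_le (hN : 2 * M ≤ N) {β : ℝ} (hβ : 0 < β) {Λ : ℝ} (hΛ : 0 < Λ)
    {B : ℝ} (hB1 : 1 ≤ B) (hB : ∀ i ≤ 3, ∀ t, ‖iteratedDeriv i salmhoferCutoff t‖ ≤ B) {μ : ℝ} {K : TrigPolyC4v} {D : ℝ}
    (hD0 : 0 ≤ D) (hD : ∀ i, 1 ≤ i → i ≤ 3 → ∀ p : Momentum, ‖iteratedFDeriv ℝ i (frameLevel μ K) p‖ ≤ D ^ i)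
    (X' : GridLeg (GridPoint L N)) (t : Fin N) (σ c : Fin 2) :
    ∑ y : TorusSite 2 L, (Torus.tnorm (X'.1.1.2 - y) : ℝ) *
        ‖((hubbardGridSub L M β N).transpose * hubbardCovAboveCT L M β μ 0 K Λ * hubbardGridSub L M β N) X' (((t, y), σ), c)‖ ≤
      96 * B * (2 * Real.pi * (1 + 4 / Λ) * D + 12 * Real.pi ^ 2 * (1 + 4 / Λ) ^ 2 * D ^ 2 + 144 * Real.pi ^ 3 * (1 + 4 / Λ) ^ 3 * D ^ 3) / Λ := by
  rw [hubbardCovAboveCT_zero_seed_eq_normalCovariance_uvSymbolCT]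
  set Cw : ℝ := 12 * B * (2 * Real.pi * (1 + 4 / Λ) * D + 12 * Real.pi ^ 2 * (1 + 4 / Λ) ^ 2 * D ^ 2 + 144 * Real.pi ^ 3 * (1 + 4 / Λ) ^ 3 * D ^ 3)
    with hCw
  have hCw0 : 0 ≤ Cw := by rw [hCw]; have := zero_le_one.trans hB1; positivity
  set u : Fin 2 → MatsubaraIdx M → TorusSite 2 L → ℂ := fun _ i kv =>
    uvSymbolFn 1 Λ (-2 * (∑ l : Fin 2, Real.cos (latticeMomentum L kv l)) - μ - K.eval (latticeMomentum L kv)) (matsubaraFreq β M i)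
    with hu
  have hp : ∀ (i : MatsubaraIdx M) (kv : TorusSite 2 L) (σ : Fin 2),
      uvSymbolCT L M β μ K Λ ((i, kv), σ) = ((β * (L : ℝ) ^ 2 : ℝ) : ℂ) * u σ i kv := fun i kv σ =>
    uvSymbolCT_eq_mul_sampled hβ μ K Λ i kv σ
  have hW : ∀ (σ : Fin 2) (i : MatsubaraIdx M), ∑ z : TorusSite 2 L, (Torus.tnorm z : ℝ) * ‖torusFourierInv (u σ i) z‖ ≤
      (2 / max |matsubaraFreq β M i| (Λ / 2)) ^ 2 * Cw := fun σ i =>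
    sum_tnorm_norm_torusFourierInv_uvBandSymbol_le_env (L := L) (μ := μ) (K := K) hΛ hB1 hB hD (matsubaraFreq β M i)
  refine (sum_tnorm_mul_norm_gridSub_pullback_sectional_le hN hβ.ne' _ u hp hW X' t σ c).trans ?_
  -- the frequency sum: `Σ_i (2/m_i)² ≤ 4·(2β/Λ)`
  have hsum : ∑ i : MatsubaraIdx M, (2 / max |matsubaraFreq β M i| (Λ / 2)) ^ 2 * Cw ≤ 4 * (2 * β / Λ) * Cw := by
    rw [← sum_mul]
    refine mul_le_mul_of_nonneg_right ?_ hCw0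
    have h := sum_inv_uvEnv_pow_le hβ hΛ M 0
    simp only [mul_zero, zero_add, pow_zero, one_mul] at h
    calc ∑ i : MatsubaraIdx M, (2 / max |matsubaraFreq β M i| (Λ / 2)) ^ 2
        = 4 * ∑ i : MatsubaraIdx M, 1 / max |matsubaraFreq β M i| (Λ / 2) ^ 2 := by
          rw [mul_sum]; exact sum_congr rfl fun i _ => by ring
      _ ≤ 4 * (2 * β / Λ) := by linarith
  have hβ0 : β ≠ 0 := hβ.ne'
  have hΛ0 : Λ ≠ 0 := hΛ.ne'
  rw [abs_of_pos hβ]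
  calc β⁻¹ * ∑ i : MatsubaraIdx M, (2 / max |matsubaraFreq β M i| (Λ / 2)) ^ 2 * Cw
      ≤ β⁻¹ * (4 * (2 * β / Λ) * Cw) := mul_le_mul_of_nonneg_left hsum (inv_nonneg.2 hβ.le)
    _ = 96 * B * (2 * Real.pi * (1 + 4 / Λ) * D + 12 * Real.pi ^ 2 * (1 + 4 / Λ) ^ 2 * D ^ 2 + 144 * Real.pi ^ 3 * (1 + 4 / Λ) ^ 3 * D ^ 3) / Λ := by
        rw [hCw]; field_simp; ring

end Model

end Summit.HubbardSuperconductivity.HubbardSuperconductivity.Theorems.TwoVolumeDefect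

end
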